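import Summits.CriticalPhenomena.PercolationContinuityZ3.Theses.PercLowPointHalfSpace
import Literature.Probability.Percolation.HalfSpaceProofs
import Literature.Probability.Percolation.SharpnessDCTProofs
import Literature.Probability.Percolation.HalfSpaceHighDimStar
import Literature.Probability.Percolation.SiteConnectionTools
import Literature.Probability.Percolation.BondPercolationSymmetry

/-!
# `QuantitativeBGN` — negative side (1/2): a half-space one-arm LOWER bound at `p_c(ℤ³)`; exponent `≤ 2`

Negative-side theorems for the crux
`Summit.CriticalPhenomena.PercolationContinuityZ3.Theses.PercLowPointHalfSpace.QuantitativeBGN`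
(stmt-CriticalPhenomena-0913; shared by the routes `PercLowPointHalfSpace`, `PercPorousCritical`,
`PercFoamCut`, `PercPortalLadder`), from the standing disprover's work file
`Cruxes/QuantitativeBGN/Disproof.lean` (cycle 1). The crux reads

  `∃ a C : ℝ, 0 < a ∧ ∀ r ≥ 1, P_{p_c(ℤ³)}(arm_H(0,r)) ≤ C r^{-a}`,

`arm_H(0,r) = {∃ y, ‖y‖∞ ≥ r ∧ 0 ↔ y in H}`, `H = {x | 0 ≤ x 0}`; here `armH r` is that event,
`QuantitativeBGNAt p` the crux at parameter `p` (`quantitativeBGN_iff : QuantitativeBGN ↔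
QuantitativeBGNAt (criticalProbI 3)` by `Iff.rfl`) and `QuantitativeBGNWith a` the crux with a fixed
exponent (`quantitativeBGN_iff_exists_with`).

TIGHTNESS OF THE EXPONENT.
* `one_le_phi_criticalProbI` : `φ_{p_c}(S) ≥ 1` for every finite `S ∋ 0`, `d ≥ 2` (Duminil-Copin–Tassion
  2016, remark after Thm 1.1), from continuity of `p ↦ φ_p(S)` (`continuous_phi`, cylinder events),
  `DCT16_expDecay_of_phi_lt_one_holds`, `theta_eq_zero_of_expDecay` and `theta_pos_of_criticalProb_lt_holds`.
* `real_openConnIn_le_armH` : every boundary term `P(0 ⟷ x in Λ_n)` of `φ(Λ_n)` is at most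
  `P(arm_H(0,n))`: the lattice symmetry `faceIso` (translate `x` to `0`, swap the coordinate of the face
  with `0`, fix the sign) maps `Λ_n` into `H`, `x` to `0` and `0` to sup-distance `n`
  (`bondPercolation_real_preimage_relabel_iso`).
* `sum_card_filter_le` : `Λ_{n+1}` has at most `6 · #(Λ_{n+1} ∖ Λ_n) ≤ 588 (n+1)²` boundary pairs.
* `armH_lower_bound` : **`P_{p_c(ℤ³)}(arm_H(0, n+1)) ≥ 1 / (588 (n+1)²)`** for every `n`.
* `not_quantitativeBGNWith_of_two_lt` : **the crux with any fixed exponent `a > 2` is FALSE**;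
  `not_expDecay_at_criticalProb` : there is no exponential rate at `p_c`.

Consequence for provers: the admissible window is `0 < a ≤ 2 = d - 1` (numerically `a = x_s ≈ 0.975`,
Deng–Blöte 2005); the boundary arm of `ℤ³` cannot take its mean-field value `3`. The load-bearing
hypotheses (`r ≥ 1`, `a > 0`, `p = p_c` exactly) are treated in the sibling file `LoadBearing.lean`.
-/

noncomputable section

namespace Summit.CriticalPhenomena.PercolationContinuityZ3.Theorems.QuantitativeBGN.Negative

open Literature.Probability.Percolation Literature.Probability.LatticeModels MeasureTheory Filter
open scoped Topology
open Summit.CriticalPhenomena.PercolationContinuityZ3.Theses.PercLowPointHalfSpace (QuantitativeBGN)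

/-! ## Readback -/

/-- The boundary one-arm event of the crux: the open cluster of `0` in the induced half-space graph
on `H = {x | 0 ≤ x 0}` reaches sup-distance `≥ r` from `0`. [folklore] -/
def armH (r : ℕ) : Set (BondConfig (Site 3)) :=
  {ω | ∃ y : Site 3, (∃ i : Fin 3, (r : ℤ) ≤ |y i|) ∧
    ω ∈ openConnIn {x : Site 3 | 0 ≤ x 0} 0 y}

/-- The crux at a general parameter `p` (the crux itself is `p = p_c(ℤ³)`). [folklore] -/
def QuantitativeBGNAt (p : unitInterval) : Prop :=
  ∃ a C : ℝ, 0 < a ∧ ∀ r : ℕ, 1 ≤ r →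
    (bondPercolation (zdGraph 3) p).real (armH r) ≤ C * (r : ℝ) ^ (-a)

/-- READBACK: the crux is literally `QuantitativeBGNAt (criticalProbI 3)`. [folklore] -/
theorem quantitativeBGN_iff : QuantitativeBGN ↔ QuantitativeBGNAt (criticalProbI 3) := Iff.rfl

/-- `0 ∈ H`. [folklore] -/
theorem zero_mem_H : (0 : Site 3) ∈ {x : Site 3 | 0 ≤ x 0} := Set.mem_setOf.mpr le_rfl

/-! ## Tightness: the exponent window is `0 < a ≤ 2` -/

section Tightness

variable {d : ℕ}

/-- `p ↦ φ_p(S)` is continuous on `[0,1]` (a polynomial: every `{0 ⟷ x in S}` is a cylinder event of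
the finite edge set `S.sym2`). [folklore] -/
theorem continuous_phi (S : Finset (Site d)) : Continuous fun p : unitInterval => DCT16.phi p S := by
  unfold DCT16.phi
  refine continuous_subtype_val.mul ?_
  refine continuous_finsetSum _ fun x _ => continuous_finsetSum _ fun y _ => ?_
  exact continuous_bondPercolation_real_of_determinedBy (zdGraph d) (F := S.sym2)
    (DCT16.determinedBy_openConnIn (↑S) 0 x (by rw [Finset.coe_sym2]))

/-- **`φ_{p_c}(S) ≥ 1` for every finite `S ∋ 0`** (`d ≥ 2`; Duminil-Copin–Tassion 2016, Remark after
Thm 1.1): otherwise, by continuity, `φ_q(S) < 1` at some `q ∈ (p_c, 1)`, whence exponential decay and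
`θ(q) = 0` at `q > p_c` — contradicting `θ(q) > 0`. [cite: DuminilCopinTassionEM2016, §2 (Remark: φ_{p_c}(Λ_n) ≥ 1)] -/
theorem one_le_phi_criticalProbI (hd : 2 ≤ d) (S : Finset (Site d)) (h0 : (0 : Site d) ∈ S) :
    1 ≤ DCT16.phi (criticalProbI d) S := by
  by_contra hlt
  push Not at hlt
  have hopen : IsOpen {q : unitInterval | DCT16.phi q S < 1} :=
    isOpen_lt (continuous_phi S) continuous_const
  obtain ⟨ε, hε, hball⟩ := Metric.isOpen_iff.1 hopen (criticalProbI d) hlt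
  have hpc1 : (criticalProbI d : ℝ) < 1 := by
    rw [coe_criticalProbI]; exact criticalProb_zd_lt_one hd
  have hpc0 : (0 : ℝ) ≤ criticalProbI d := (criticalProbI d).2.1
  set qr : ℝ := min ((criticalProbI d : ℝ) + ε / 2) (((criticalProbI d : ℝ) + 1) / 2) with hqr
  have hq_gt : (criticalProbI d : ℝ) < qr := lt_min (by linarith) (by linarith)
  have hq_lt1 : qr < 1 := (min_le_right _ _).trans_lt (by linarith)
  have hq_eps : qr < (criticalProbI d : ℝ) + ε := (min_le_left _ _).trans_lt (by linarith)
  have hq01 : qr ∈ unitInterval := ⟨hpc0.trans hq_gt.le, hq_lt1.le⟩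
  have hqball : (⟨qr, hq01⟩ : unitInterval) ∈ Metric.ball (criticalProbI d) ε := by
    rw [Metric.mem_ball, Subtype.dist_eq, Real.dist_eq, abs_lt]
    constructor <;> push_cast <;> linarith
  have hφq : DCT16.phi ⟨qr, hq01⟩ S < 1 := hball hqball
  obtain ⟨c, hc, hdec⟩ := DCT16.DCT16_expDecay_of_phi_lt_one_holds ⟨qr, hq01⟩ S h0 hφq hq_lt1
  have hθ0 := DCT16.theta_eq_zero_of_expDecay ⟨qr, hq01⟩ hc hdec
  have hθpos : 0 < theta (zdGraph d) 0 ⟨qr, hq01⟩ :=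
    theta_pos_of_criticalProb_lt_holds (zdGraph d) 0 ⟨qr, hq01⟩ (by
      rw [coe_criticalProbI] at hq_gt; exact hq_gt)
  linarith


/-! ### Face isomorphisms -/

/-- If a lattice symmetry `g` maps `Λ_n` into `H`, `x` to `0`, and `0` to sup-distance `≥ n`, then
`P(0 ⟷ x in Λ_n) ≤ P(arm_H(0, n))`. [folklore] -/
theorem real_openConnIn_le_armH_of_iso (p : unitInterval) {n : ℕ} {x : Site 3}
    (g : zdGraph 3 ≃g zdGraph 3) (hH : ∀ z ∈ ((box 3 n : Finset (Site 3)) : Set (Site 3)), 0 ≤ g.toEquiv z 0)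
    (hx : g.toEquiv x = 0) (h0 : ∃ j : Fin 3, (n : ℤ) ≤ |g.toEquiv 0 j|) :
    (bondPercolation (zdGraph 3) p).real (openConnIn (↑(box 3 n)) 0 x) ≤
      (bondPercolation (zdGraph 3) p).real (armH n) := by
  rw [← bondPercolation_real_preimage_relabel_iso g p (armH n)]
  refine measureReal_mono fun ω hω => ?_
  rw [Set.mem_preimage]
  have hpath := (DCT16.mem_openConnIn_iff_pathIn.1 hω).symm
  have hmap := DCT16.pathIn_map (G' := openGraph (BondConfig.relabel (sym2Equiv g.toEquiv) ω))
    g.toEquiv (B := {z : Site 3 | 0 ≤ z 0}) hH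
    (fun a b _ _ hab => (openGraph_relabel_adj_iff g.toEquiv ω a b).2 hab) hpath
  rw [hx] at hmap
  exact ⟨g.toEquiv 0, h0, DCT16.mem_openConnIn_of_pathIn hmap⟩

/-- The symmetry attached to the face `{z_i = -s·n}`: translate `x` to `0`, swap coordinates `0, i`
and multiply the new `0`-th coordinate by `s`. [folklore] -/
def faceIso (x : Site 3) (i : Fin 3) (s : ℤˣ) : zdGraph 3 ≃g zdGraph 3 :=
  (zdShiftIso (-x)).trans (zdSignedPermIso (Equiv.swap 0 i) (Function.update 1 0 s))

/-- The new height: `(faceIso x i s z) 0 = s (z_i - x_i)`. [folklore] -/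
theorem faceIso_apply_zero (x : Site 3) (i : Fin 3) (s : ℤˣ) (z : Site 3) :
    (faceIso x i s).toEquiv z 0 = (s : ℤ) * (z i - x i) := by
  simp [faceIso, sub_eq_add_neg]

/-- `faceIso x i s x = 0`. [folklore] -/
theorem faceIso_apply_self (x : Site 3) (i : Fin 3) (s : ℤˣ) : (faceIso x i s).toEquiv x = 0 := by
  simp [faceIso]

/-- A boundary pair `x ∈ Λ_n ∌ y`, `x ∼ y`, sits on a face: `x_i = ±n` for some `i`. [folklore] -/
theorem exists_face_of_boundary_pair {n : ℕ} {x y : Site 3} (hx : x ∈ box 3 n) (hy : y ∉ box 3 n)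
    (hxy : (zdGraph 3).Adj x y) : ∃ i : Fin 3, x i = n ∨ x i = -n := by
  rw [mem_box] at hx
  rw [mem_box, not_forall] at hy
  obtain ⟨i, hi⟩ := hy
  have h1 := DCT16.abs_sub_le_one_of_adj hxy i
  have h2 := hx i
  refine ⟨i, ?_⟩
  rw [abs_le] at h1
  omega

/-- **Each boundary term of `φ(Λ_n)` is a half-space arm probability**: for `x ∈ Λ_n`, `y ∉ Λ_n`,
`x ∼ y`: `P_p(0 ⟷ x in Λ_n) ≤ P_p(arm_H(0,n))`. [folklore] -/
theorem real_openConnIn_le_armH (p : unitInterval) {n : ℕ} {x y : Site 3} (hx : x ∈ box 3 n)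
    (hy : y ∉ box 3 n) (hxy : (zdGraph 3).Adj x y) :
    (bondPercolation (zdGraph 3) p).real (openConnIn (↑(box 3 n)) 0 x) ≤
      (bondPercolation (zdGraph 3) p).real (armH n) := by
  obtain ⟨i, hi⟩ := exists_face_of_boundary_pair hx hy hxy
  obtain ⟨s, hs1, hs⟩ : ∃ s : ℤˣ, ((s : ℤ) = 1 ∨ (s : ℤ) = -1) ∧ (s : ℤ) * x i = -n := by
    rcases hi with h | h
    · exact ⟨-1, Or.inr (by simp), by rw [h]; simp⟩
    · exact ⟨1, Or.inl (by simp), by rw [h]; simp⟩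
  refine real_openConnIn_le_armH_of_iso p (faceIso x i s) ?_ (faceIso_apply_self x i s) ?_
  · intro z hz
    rw [Finset.mem_coe, mem_box] at hz
    have hzi := hz i
    rw [faceIso_apply_zero]
    rcases hs1 with h1 | h1 <;> rw [h1] at hs ⊢ <;> omega
  · refine ⟨0, ?_⟩
    rw [faceIso_apply_zero, le_abs]
    left
    rcases hs1 with h1 | h1 <;> rw [h1] at hs ⊢ <;> simp <;> omega


/-! ### Counting boundary pairs and the lower bound -/

/-- The number of boundary pairs `(x, y)`, `x ∈ Λ_{n+1} ∌ y`, `x ∼ y`, is at most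
`6 · #(Λ_{n+1} ∖ Λ_n) ≤ 588 (n+1)²`. [folklore] -/
theorem sum_card_filter_le (n : ℕ) :
    ∑ x ∈ box 3 (n + 1), ((((zdGraph 3).neighborFinset x).filter (fun y => y ∉ box 3 (n + 1))).card : ℝ)
      ≤ 588 * ((n : ℝ) + 1) ^ 2 := by
  have hsub : box 3 n ⊆ box 3 (n + 1) := box_mono 3 (Nat.le_succ n)
  have hsplit := Finset.sum_sdiff hsub
    (f := fun x => (((zdGraph 3).neighborFinset x).filter (fun y => y ∉ box 3 (n + 1))).card)
  have hinner : ∑ x ∈ box 3 n, (((zdGraph 3).neighborFinset x).filter (fun y => y ∉ box 3 (n + 1))).card = 0 := by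
    refine Finset.sum_eq_zero fun x hx => ?_
    rw [Finset.card_eq_zero, Finset.filter_eq_empty_iff]
    intro y hy
    rw [not_not]
    exact DCT16.mem_box_succ_of_adj hx ((SimpleGraph.mem_neighborFinset _ _ _).1 hy)
  have hshell : ∑ x ∈ box 3 (n + 1) \ box 3 n,
      (((zdGraph 3).neighborFinset x).filter (fun y => y ∉ box 3 (n + 1))).card ≤
        6 * (box 3 (n + 1) \ box 3 n).card := by
    calc _ ≤ ∑ x ∈ box 3 (n + 1) \ box 3 n, 2 * 3 :=
          Finset.sum_le_sum fun x _ => (Finset.card_filter_le _ _).trans (card_neighborFinset_zdGraph_holds x).le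
      _ = _ := by rw [Finset.sum_const, smul_eq_mul, mul_comm]
  have htotal : ∑ x ∈ box 3 (n + 1), (((zdGraph 3).neighborFinset x).filter (fun y => y ∉ box 3 (n + 1))).card ≤
      6 * (box 3 (n + 1) \ box 3 n).card := by
    rw [← hsplit, hinner, add_zero]; exact hshell
  have hcard : ((box 3 (n + 1) \ box 3 n).card : ℝ) ≤ 98 * ((n : ℝ) + 1) ^ 2 := by
    rw [Finset.card_sdiff_of_subset hsub, Nat.cast_sub (Finset.card_le_card hsub), card_box, card_box]
    push_cast
    have hn : (0 : ℝ) ≤ n := Nat.cast_nonneg n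
    nlinarith [sq_nonneg (n : ℝ)]
  rw [← Nat.cast_sum]
  calc (_ : ℝ) ≤ ((6 * (box 3 (n + 1) \ box 3 n).card : ℕ) : ℝ) := by exact_mod_cast htotal
    _ = 6 * ((box 3 (n + 1) \ box 3 n).card : ℝ) := by push_cast; ring
    _ ≤ 6 * (98 * ((n : ℝ) + 1) ^ 2) := by gcongr
    _ = 588 * ((n : ℝ) + 1) ^ 2 := by ring

/-- **Half-space one-arm lower bound at `p_c(ℤ³)`**: `P_{p_c}(arm_H(0, n+1)) ≥ 1 / (588 (n+1)²)`.
From `φ_{p_c}(Λ_{n+1}) ≥ 1` (`one_le_phi_criticalProbI`): each of the `≤ 588 (n+1)²` boundary terms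
`P(0 ⟷ x in Λ_{n+1})` is at most `P(arm_H(0, n+1))` (`real_openConnIn_le_armH`, lattice symmetry).
[folklore] -/
theorem armH_lower_bound (n : ℕ) :
    1 / (588 * ((n : ℝ) + 1) ^ 2) ≤
      (bondPercolation (zdGraph 3) (criticalProbI 3)).real (armH (n + 1)) := by
  set q := (bondPercolation (zdGraph 3) (criticalProbI 3)).real (armH (n + 1)) with hq
  have hφ := one_le_phi_criticalProbI (d := 3) (by norm_num) (box 3 (n + 1)) (zero_mem_box 3 (n + 1))
  rw [DCT16.phi_def] at hφ
  have hsum : ∑ x ∈ box 3 (n + 1), ∑ y ∈ (zdGraph 3).neighborFinset x with y ∉ box 3 (n + 1),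
      (bondPercolation (zdGraph 3) (criticalProbI 3)).real (openConnIn (↑(box 3 (n + 1))) 0 x) ≤
      (∑ x ∈ box 3 (n + 1), ((((zdGraph 3).neighborFinset x).filter (fun y => y ∉ box 3 (n + 1))).card : ℝ)) * q := by
    rw [Finset.sum_mul]
    refine Finset.sum_le_sum fun x hx => ?_
    rw [← nsmul_eq_mul, ← Finset.sum_const]
    refine Finset.sum_le_sum fun y hy => ?_
    obtain ⟨hy1, hy2⟩ := Finset.mem_filter.1 hy
    exact real_openConnIn_le_armH _ hx hy2 ((SimpleGraph.mem_neighborFinset _ _ _).1 hy1)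
  have hN := sum_card_filter_le n
  have hpc1 : ((criticalProbI 3 : unitInterval) : ℝ) ≤ 1 := (criticalProbI 3).2.2
  have hq0 : 0 ≤ q := measureReal_nonneg
  have hS0 : 0 ≤ ∑ x ∈ box 3 (n + 1), ∑ y ∈ (zdGraph 3).neighborFinset x with y ∉ box 3 (n + 1),
      (bondPercolation (zdGraph 3) (criticalProbI 3)).real (openConnIn (↑(box 3 (n + 1))) 0 x) :=
    Finset.sum_nonneg fun _ _ => Finset.sum_nonneg fun _ _ => measureReal_nonneg
  have h1 : (1 : ℝ) ≤ 588 * ((n : ℝ) + 1) ^ 2 * q := by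
    calc (1 : ℝ) ≤ _ := hφ
      _ ≤ 1 * ((∑ x ∈ box 3 (n + 1),
            ((((zdGraph 3).neighborFinset x).filter (fun y => y ∉ box 3 (n + 1))).card : ℝ)) * q) :=
          mul_le_mul hpc1 hsum hS0 zero_le_one
      _ ≤ 1 * (588 * ((n : ℝ) + 1) ^ 2 * q) := by gcongr
      _ = _ := one_mul _
  have hpos : (0 : ℝ) < 588 * ((n : ℝ) + 1) ^ 2 := by positivity
  rw [div_le_iff₀ hpos]
  linarith

/-- The crux at `p_c(ℤ³)` with a FIXED exponent `a` (so `QuantitativeBGN ↔ ∃ a > 0, QuantitativeBGNWith a`).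
[folklore] -/
def QuantitativeBGNWith (a : ℝ) : Prop :=
  ∃ C : ℝ, ∀ r : ℕ, 1 ≤ r →
    (bondPercolation (zdGraph 3) (criticalProbI 3)).real (armH r) ≤ C * (r : ℝ) ^ (-a)


/-- `QuantitativeBGN ↔ ∃ a > 0, QuantitativeBGNWith a`. [folklore] -/
theorem quantitativeBGN_iff_exists_with : QuantitativeBGN ↔ ∃ a : ℝ, 0 < a ∧ QuantitativeBGNWith a := by
  constructor
  · rintro ⟨a, C, ha, h⟩; exact ⟨a, ha, C, h⟩
  · rintro ⟨a, ha, C, h⟩; exact ⟨a, C, ha, h⟩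

/-- **Tightness: the exponent cannot exceed `2 = d - 1`.** For every `a > 2` the crux's bound with
exponent `a` is false at `p_c(ℤ³)` (`armH_lower_bound`: `P ≥ 1/(588 r²)` versus `C r^{-a}`).
[folklore] -/
theorem not_quantitativeBGNWith_of_two_lt {a : ℝ} (ha : 2 < a) : ¬ QuantitativeBGNWith a := by
  rintro ⟨C, h⟩
  -- for every r ≥ 1: r^(a-2) ≤ 588 C
  have hbd : ∀ r : ℕ, 1 ≤ r → (r : ℝ) ^ (a - 2) ≤ 588 * C := by
    intro r hr
    have hr0 : (0 : ℝ) < r := by exact_mod_cast hr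
    have hlow := armH_lower_bound (r - 1)
    have hr1 : ((r - 1 : ℕ) : ℝ) + 1 = r := by
      rw [Nat.cast_sub hr, Nat.cast_one]; ring
    have hr2 : r - 1 + 1 = r := by omega
    rw [hr1, hr2] at hlow
    have hup := h r hr
    have key : 1 / (588 * (r : ℝ) ^ 2) ≤ C * (r : ℝ) ^ (-a) := hlow.trans hup
    rw [div_le_iff₀ (by positivity)] at key
    -- key : 1 ≤ C * r^(-a) * (588 r^2)
    have hsplit : (r : ℝ) ^ (a - 2) * ((r : ℝ) ^ (-a) * (r : ℝ) ^ 2) = 1 := by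
      rw [← Real.rpow_natCast (r : ℝ) 2, ← Real.rpow_add hr0, ← Real.rpow_add hr0]
      norm_num
    calc (r : ℝ) ^ (a - 2) = (r : ℝ) ^ (a - 2) * 1 := (mul_one _).symm
      _ ≤ (r : ℝ) ^ (a - 2) * (C * (r : ℝ) ^ (-a) * (588 * (r : ℝ) ^ 2)) := by
          gcongr
      _ = 588 * C * ((r : ℝ) ^ (a - 2) * ((r : ℝ) ^ (-a) * (r : ℝ) ^ 2)) := by ring
      _ = 588 * C := by rw [hsplit, mul_one]
  -- but r^(a-2) → ∞
  have ht : Tendsto (fun r : ℕ => (r : ℝ) ^ (a - 2)) atTop atTop :=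
    (tendsto_rpow_atTop (by linarith)).comp tendsto_natCast_atTop_atTop
  obtain ⟨r, hr⟩ := (ht.eventually_gt_atTop (588 * C)).and (eventually_ge_atTop 1) |>.exists
  exact absurd (hbd r hr.2) (not_le.mpr hr.1)

/-- **Natural strengthening refuted: no exponential rate at `p_c`.** [folklore] -/
theorem not_expDecay_at_criticalProb :
    ¬ ∃ c C : ℝ, 0 < c ∧ ∀ r : ℕ, 1 ≤ r →
      (bondPercolation (zdGraph 3) (criticalProbI 3)).real (armH r) ≤ C * Real.exp (-c * r) := by
  rintro ⟨c, C, hc, h⟩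
  have hbd : ∀ r : ℕ, 1 ≤ r → Real.exp (c * r) / (r : ℝ) ^ (2 : ℝ) ≤ 588 * C := by
    intro r hr
    have hr0 : (0 : ℝ) < r := by exact_mod_cast hr
    have hlow := armH_lower_bound (r - 1)
    have hr1 : ((r - 1 : ℕ) : ℝ) + 1 = r := by
      rw [Nat.cast_sub hr, Nat.cast_one]; ring
    have hr2 : r - 1 + 1 = r := by omega
    rw [hr1, hr2] at hlow
    have key : 1 / (588 * (r : ℝ) ^ 2) ≤ C * Real.exp (-c * r) := hlow.trans (h r hr)
    rw [div_le_iff₀ (by positivity)] at key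
    rw [Real.rpow_two, div_le_iff₀ (by positivity)]
    have hexp : Real.exp (c * r) * (C * Real.exp (-c * r) * (588 * (r : ℝ) ^ 2)) = 588 * C * (r : ℝ) ^ 2 := by
      have : Real.exp (c * r) * Real.exp (-c * r) = 1 := by
        rw [← Real.exp_add]; norm_num
      calc _ = 588 * C * (r : ℝ) ^ 2 * (Real.exp (c * r) * Real.exp (-c * r)) := by ring
        _ = _ := by rw [this, mul_one]
    calc Real.exp (c * r) = Real.exp (c * r) * 1 := (mul_one _).symm
      _ ≤ Real.exp (c * r) * (C * Real.exp (-c * r) * (588 * (r : ℝ) ^ 2)) := by gcongr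
      _ = 588 * C * (r : ℝ) ^ 2 := hexp
  have ht : Tendsto (fun r : ℕ => Real.exp (c * r) / (r : ℝ) ^ (2 : ℝ)) atTop atTop :=
    (tendsto_exp_mul_div_rpow_atTop 2 c hc).comp tendsto_natCast_atTop_atTop
  obtain ⟨r, hr⟩ := (ht.eventually_gt_atTop (588 * C)).and (eventually_ge_atTop 1) |>.exists
  exact absurd (hbd r hr.2) (not_le.mpr hr.1)

end Tightness

end Summit.CriticalPhenomena.PercolationContinuityZ3.Theorems.QuantitativeBGN.Negative

end
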